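import Summits.BirchSwinnertonDyer.BirchSwinnertonDyer.Theorems.EisensteinPrimesGoodLatticeKatzMeasureReflectTransport
import Summits.BirchSwinnertonDyer.BirchSwinnertonDyer.Theorems.PrintCf2RubinValueTwoGoodTwistDictionaryN
import Summits.BirchSwinnertonDyer.BirchSwinnertonDyer.Theorems.EisensteinPrimesKatzLineFactor
import HarnessLib

set_option linter.dupNamespace false
set_option autoImplicit false

/-!
# THE REFLECTED FRAME `λ̌` OF de Shalit II.6.4 EXISTS AT EVERY PERIOD TRIPLE CARRYING A `λ`-FRAME (every imaginary quadratic `K`,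
# every split `p`): interpolation pairs of the frame are genuine off `v̄`, so file 5's transport is unconditional

Cell `bsd-eis`, width seat `bsd-line-x1-p1-w2` gen 32; `--supports stmt-BirchSwinnertonDyer-19032` (crux 2 `GoodLatticeBDPValue`, line
`halves` v34N; helper, closes nothing).  File 6 of the thmII64 certificates.  THEOREMS ONLY (no `def`, no named fact, no `sorry`).

* `eq_or_eq_of_natCast_mem` — in an imaginary quadratic field a prime containing the split `p = v v̄` is `v` or `v̄`.
* `isUnramifiedAt_of_reflectPair` — **every interpolation pair `(ρ', r')` of the `λ̌`-frame is GENUINE off `v̄`**: `ρ'` is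
  unramified at every `w ≠ v̄` — away from `p` because its avatar `r'` through the `ℤ_p²`-tower is
  (`PrintCf2.GoodTwistDictN.isUnramifiedAt_of_factorsThroughPair`) and Serre's local–global dictionary
  (`PrintCf2.GoodTwistDictN.isUnramifiedAt_of_isPAdicAvatarOf_of_isUnramifiedAt`); at `v` because `λ̌ρ'` and `λ̌` are (`c • v = v̄ ∉ S`).
* `reflectFrame_transport` — **THE `λ̌`-FRAME AT THE SECOND TRIPLE**: `v̄ ∉ S`, `λ` of type `(k, j)` unramified off `S`, topological
  pair, `G ≠ 0`, `G'` frames of `λ` at `(Ω, δ, Ω_p)`, `(Ω', δ', Ω_p')`, `U = G'/G`, `Ǧ` a `λ̌`-frame at `(Ω, δ, Ω_p)` ⟹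
  `C(C κ₀)·U·Ǧ` IS an `IsKatzMeasure₂ … (reflect λ) Ω' δ' Ω_p'`-frame (`κ₀ = B^{−(k+j+1)}`, norm one).  This is the EXISTENCE
  half of what the ∀-period phrasing of `DeShalit1987.thmII64_katzMeasure₂_functionalEquation` asserts beyond print, now a theorem;
  the relation half is file 7.

HONEST FRAMING: helper theorems; nothing here proves a summit statement, the crux, a stub, BSD, or a theorem of de Shalit / Katz /
Rubin; 0 cells / labels / tiers move.

References: [deShalit1987] II.4.12 Rem. (iii)–(iv), II.4.16–17, II.6.1 (1), II.6.4 (p. 84–85); [SerreAbelianLadic1968] II §2.7, III §2.3;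
[CasselsFrohlichANT1967] VII Prop. 1.2; [Washington1997] Prop. 13.2.
-/

noncomputable section

open scoped NumberField Classical Topology
open Filter NumberField IsDedekindDomain Field
open Literature Literature.NumberTheory.GaloisRepresentations Literature.NumberTheory.EllipticCurves
open Literature.NumberTheory.EllipticCurves.DeShalit1987
open Summit.BirchSwinnertonDyer.Rank1Residual.X11b Summit.BirchSwinnertonDyer.Rank1Residual.X11b.LambdaSupply
open Summit.BirchSwinnertonDyer.Rank1Residual.X11b.Three.LambdaSupply
open Summit.BirchSwinnertonDyer.BirchSwinnertonDyer.Theorems.GoodLatticeKatzMeasureUniqueness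
open Summit.BirchSwinnertonDyer.BirchSwinnertonDyer.Theorems.GoodLatticeKatzMeasureUniquenessBinders
open Summit.BirchSwinnertonDyer.BirchSwinnertonDyer.Theorems.GoodLatticeKatzMeasurePeriodRigidity
open Summit.BirchSwinnertonDyer.BirchSwinnertonDyer.Theorems.GoodLatticeKatzMeasureRigidityUnitValues
open Summit.BirchSwinnertonDyer.BirchSwinnertonDyer.Theorems.GoodLatticeKatzMeasureReflectTransport

namespace Summit.BirchSwinnertonDyer.BirchSwinnertonDyer.Theorems.GoodLatticeKatzMeasureReflectFrame

variable {p : ℕ} [Fact p.Prime] {K : Type} [Field K] [NumberField K]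

/-! ### §7 The two primes above `p`; genuineness of interpolation pairs; THE REFLECTED FRAME AT THE SECOND PERIOD TRIPLE -/

/-- In an imaginary quadratic field a prime containing the split rational prime `p = v v̄` is `v` or `v̄` (`Gal(K/ℚ) = {1, c}` acts
transitively on the primes above `p`, and `c • v = v̄`). [cite: CasselsFrohlichANT1967, Ch. VII Prop. 1.2 (ii)] -/
theorem eq_or_eq_of_natCast_mem [IsCMField K] (hK : IsImaginaryQuadratic K) {v vbar : HeightOneSpectrum (𝓞 K)}
    (hv : ((p : ℕ) : 𝓞 K) ∈ v.asIdeal) (hvbar : ((p : ℕ) : 𝓞 K) ∈ vbar.asIdeal) (hne : vbar ≠ v)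
    {w : HeightOneSpectrum (𝓞 K)} (hw : ((p : ℕ) : 𝓞 K) ∈ w.asIdeal) : w = v ∨ w = vbar := by
  haveI : Algebra.IsQuadraticExtension ℚ K := ⟨hK.1⟩
  haveI : IsGalois ℚ K := inferInstance
  have hp : p.Prime := Fact.out
  obtain ⟨σ, hσ⟩ := Literature.NumberTheory.Automorphic.HeightOneSpectrum.exists_algEquiv_smul_eq (F := ℚ) (E := K)
    (KatzLineFrame.under_rat_eq_of_natCast_mem hp hv hw)
  by_cases hσ1 : σ = 1
  · left; rw [hσ1, one_smul] at hσ; exact hσ.symm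
  · right
    have hσc : σ = (IsCMField.complexConj K).restrictScalars ℚ :=
      algEquiv_eq_of_ne_one_of_finrank_eq_two hK.1 hσ1 restrictScalars_complexConj_ne_one
    rw [hσc] at hσ
    have hcv : IsCMField.complexConj K • v = vbar := KatzLineFrame.complexConj_smul_eq_of_ne hK hp hv hvbar hne
    rw [← hσ]
    exact hcv

/-- **Interpolation pairs of the reflected frame are GENUINE off `v̄`**: in the binders of the `λ̌`-frame at `c • S` (`λ` of type
`(k, j)` unramified off `S`, `v̄ ∉ S`), for every pair `(ρ', r')` with `r'` through the `ℤ_p²`-tower, `IsPAdicAvatarOf ι ρ' r'`,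
`λ̌ρ'` of type `(−m', j')` and unramified off `c • S ∪ {v̄}`, the character `ρ'` is unramified at EVERY `w ≠ v̄`: away from `p`
because `r'` is (`PrintCf2.GoodTwistDictN.isUnramifiedAt_of_factorsThroughPair` + Serre's local–global
`isUnramifiedAt_of_isPAdicAvatarOf_of_isUnramifiedAt`), at `v` because `λ̌ρ'` and `λ̌` are (`c • v = v̄ ∉ S`).
[cite: SerreAbelianLadic1968, Ch. II §2.7, Ch. III §2.3] [cite: Washington1997, Prop. 13.2] [cite: deShalit1987, II.6.1 (1)] -/
theorem isUnramifiedAt_of_reflectPair [IsCMField K] (hK : IsImaginaryQuadratic K)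
    {ι : PadicAlgCl p ≃+* ℂ} {v vbar : HeightOneSpectrum (𝓞 K)}
    (hv : ((p : ℕ) : 𝓞 K) ∈ v.asIdeal) (hvbar : ((p : ℕ) : 𝓞 K) ∈ vbar.asIdeal) (hne : vbar ≠ v)
    {S : Finset (HeightOneSpectrum (𝓞 K))} (hvbS : vbar ∉ S) {lam : HeckeCharacter K} {kl jl : ℤ}
    (hlam : lam.HasInfinityType (fun _ ↦ kl) (fun _ ↦ jl))
    (hlamS : ∀ w : HeightOneSpectrum (𝓞 K), w ∉ S → lam.IsUnramifiedAt w)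
    {κ₁ κ₂ : ZpExtension K p} {ρ' : HeckeCharacter K} {r' : FramedGaloisRep K (PadicAlgCl p) 1} {m' j' : ℕ}
    (hr' : IsPAdicAvatarOf ι ρ' r') (hκ' : FactorsThroughPair κ₁ κ₂ r')
    (hinf : (reflect lam * ρ').HasInfinityType (fun _ ↦ -(m' : ℤ)) (fun _ ↦ (j' : ℤ)))
    (hunr : ∀ w : HeightOneSpectrum (𝓞 K), w ∉ (S.image fun w ↦ IsCMField.complexConj K • w) → w ≠ vbar →
      (reflect lam * ρ').IsUnramifiedAt w) :
    ∀ w : HeightOneSpectrum (𝓞 K), w ≠ vbar → ρ'.IsUnramifiedAt w := by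
  have hp : p.Prime := Fact.out
  -- the type of `ρ'`
  have hlt := hasInfinityType_reflect hlam
  have hρt : ρ'.HasInfinityType (fun _ ↦ jl + 1 - (m' : ℤ)) (fun _ ↦ kl + 1 + (j' : ℤ)) := by
    have h := hlt.inv.mul' hinf
    rw [inv_mul_cancel_left] at h
    have e1 : (-(fun w : InfinitePlace K ↦ -(fun _ : InfinitePlace K ↦ jl) w - 1) + fun _ ↦ -(m' : ℤ)) =
        fun _ ↦ jl + 1 - (m' : ℤ) := by
      funext w'; simp only [Pi.add_apply, Pi.neg_apply]; ring
    have e2 : (-(fun w : InfinitePlace K ↦ -(fun _ : InfinitePlace K ↦ kl) w - 1) + fun _ ↦ (j' : ℤ)) =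
        fun _ ↦ kl + 1 + (j' : ℤ) := by
      funext w'; simp only [Pi.add_apply, Pi.neg_apply]; ring
    exact Eq.mp (congrArg₂ (fun f g ↦ ρ'.HasInfinityType f g) e1 e2) h
  intro w hw
  by_cases hpw : ((p : ℕ) : 𝓞 K) ∈ w.asIdeal
  · -- `w = v`: `λ̌ρ'` and `λ̌` are unramified at `v`
    rcases eq_or_eq_of_natCast_mem hK hv hvbar hne hpw with rfl | rfl
    · have hcv : IsCMField.complexConj K • w = vbar := KatzLineFrame.complexConj_smul_eq_of_ne hK hp hv hvbar hne
      have hcc : IsCMField.complexConj K * IsCMField.complexConj K = 1 := by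
        rw [← pow_two, ← IsCMField.orderOf_complexConj K, pow_orderOf_eq_one]
      have hvS : w ∉ (S.image fun w ↦ IsCMField.complexConj K • w) := fun h ↦ by
        obtain ⟨w₁, hw₁, hw₁'⟩ := Finset.mem_image.mp h
        apply hvbS
        have : w₁ = vbar := by
          rw [← hcv, ← hw₁', smul_smul, hcc, one_smul]
        rw [← this]; exact hw₁
      have h1 : (reflect lam * ρ').IsUnramifiedAt w := hunr w hvS hw
      have h2 : (reflect lam).IsUnramifiedAt w :=
        (isUnramifiedAt_reflect_iff lam w).mpr (hlamS _ (by rw [hcv]; exact hvbS))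
      have h3 := h2.inv'.mul' h1
      rwa [inv_mul_cancel_left] at h3
    · exact absurd rfl hw
  · exact PrintCf2.GoodTwistDictN.isUnramifiedAt_of_isPAdicAvatarOf_of_isUnramifiedAt hρt ι hr' hpw
      (PrintCf2.GoodTwistDictN.isUnramifiedAt_of_factorsThroughPair hκ' hpw)

/-- **THE REFLECTED FRAME EXISTS AT THE SECOND PERIOD TRIPLE.** `K` imaginary quadratic (any class number), `p = v v̄` any split
prime, `v̄ ∉ S`, `λ` of type `(k, j)` unramified at every `w ∉ S`, topological pair; `G ≠ 0`, `G'` frames of `λ` at `(Ω, δ, Ω_p)`,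
`(Ω', δ', Ω_p')` (six non-zero period quantities), `U` with `G' = U·G`, and `Ǧ` a frame of `λ̌ = reflect λ` (at `c • S`) at
`(Ω, δ, Ω_p)`.  THEN `C(C κ₀)·U·Ǧ` IS a frame of `λ̌` at `(Ω', δ', Ω_p')`, `κ₀ = B^{−(k+j+1)}` of norm one — the EXISTENCE of the
`λ̌`-measure's frame at ANY period triple carrying a `λ`-frame, the existence half of what the ∀-period phrasing of
`DeShalit1987.thmII64_katzMeasure₂_functionalEquation` asserts beyond print (§6 + genuineness of interpolation pairs).
[cite: deShalit1987, II.4.12 Remarks (iii)–(iv), II.4.16 (49)–(50), II.4.17 (51)–(54), II.6.1 (1), II.6.4 Theorem (i) (store chunk 84–85)]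
[cite: SerreAbelianLadic1968, Ch. II §2.7] -/
theorem reflectFrame_transport [IsCMField K] (hK : IsImaginaryQuadratic K)
    {ι : PadicAlgCl p ≃+* ℂ} {v vbar : HeightOneSpectrum (𝓞 K)}
    (hv : ((p : ℕ) : 𝓞 K) ∈ v.asIdeal) (hvbar : ((p : ℕ) : 𝓞 K) ∈ vbar.asIdeal) (hne : vbar ≠ v)
    (hι : ∀ (w : InfinitePlace K) (d : 𝓞 K), d ∈ v.asIdeal ↔ ‖ι.symm (w.embedding (d : K))‖ < 1)
    {S : Finset (HeightOneSpectrum (𝓞 K))} (hvbS : vbar ∉ S) {lam : HeckeCharacter K} {kl jl : ℤ}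
    (hlam : lam.HasInfinityType (fun _ ↦ kl) (fun _ ↦ jl))
    (hlamS : ∀ w : HeightOneSpectrum (𝓞 K), w ∉ S → lam.IsUnramifiedAt w)
    {κ₁ κ₂ : ZpExtension K p} {γ₁ γ₂ : absoluteGaloisGroup K}
    (hpair : ZpExtension.IsTopGeneratorPair κ₁ κ₂ γ₁ γ₂)
    {Ω δ Ω' δ' : ℂ} {Ωp Ωp' : ℂ_[p]} {G G' U Gc : PowerSeries (PowerSeries (PadicComplexInt p))}
    (hG : IsKatzMeasure₂ ι v vbar S κ₁ κ₂ γ₁ γ₂ lam Ω δ Ωp G)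
    (hG' : IsKatzMeasure₂ ι v vbar S κ₁ κ₂ γ₁ γ₂ lam Ω' δ' Ωp' G')
    (hΩ : Ω ≠ 0) (hδ : δ ≠ 0) (hΩp : Ωp ≠ 0) (hΩ' : Ω' ≠ 0) (hδ' : δ' ≠ 0) (hΩp' : Ωp' ≠ 0)
    (hG0 : G ≠ 0) (hU : G' = U * G)
    (hGc : IsKatzMeasure₂ ι v vbar (S.image fun w ↦ IsCMField.complexConj K • w) κ₁ κ₂ γ₁ γ₂
      (reflect lam) Ω δ Ωp Gc) :
    ∃ κ₀ : PadicComplexInt p, ‖(κ₀ : ℂ_[p])‖ = 1 ∧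
      IsKatzMeasure₂ ι v vbar (S.image fun w ↦ IsCMField.complexConj K • w) κ₁ κ₂ γ₁ γ₂ (reflect lam) Ω' δ' Ωp'
        (PowerSeries.C (PowerSeries.C κ₀) * U * Gc) := by
  have hlamu : ∀ w : HeightOneSpectrum (𝓞 K), w ∉ S → w ≠ vbar → lam.IsUnramifiedAt w := fun w hw _ ↦ hlamS w hw
  obtain ⟨κ₀, hκ₀, hframe⟩ := reflectFrame_transport_on_unramified hK hv hvbar hne hι hlam hlamu hpair hG hG' hΩ hδ hΩp
    hΩ' hδ' hΩp' hG0 hU hGc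
  refine ⟨κ₀, hκ₀, fun ρ' r' m' j' hr' hκ' hjm hinf hunr hL ↦ ?_⟩
  exact hframe ρ' r' m' j' hr' hκ' hjm hinf hunr
    (isUnramifiedAt_of_reflectPair hK hv hvbar hne hvbS hlam hlamS hr' hκ' hinf hunr) hL

end Summit.BirchSwinnertonDyer.BirchSwinnertonDyer.Theorems.GoodLatticeKatzMeasureReflectFrame

end
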